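import Mathlib
import HarnessLib
import Summits.ResolutionOfSingularities.ResolutionOfSingularities.Theorems.WildQuotientsWildQuotientResolutionThirdConeBlowup
import Summits.ResolutionOfSingularities.ResolutionOfSingularities.Theorems.WildQuotientsWildQuotientResolutionThirdConeVertexPrime
import Summits.ResolutionOfSingularities.ResolutionOfSingularities.Theorems.WildQuotientsWildQuotientResolutionHalf111BlowupAway
import Summits.ResolutionOfSingularities.ResolutionOfSingularities.Theorems.WildQuotientsWildQuotientResolutionConeVertexAwayContraction

/-!
# Theorem T3, localised: the cone side of a `μ₃` ring brick (`⅓(1^a,2^b) × 𝔸^c` at an element off the vertex)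
(crux stmt-ResolutionOfSingularities-15640 `WildQuotients.WildQuotientResolution`, line `Sketch`;
chain w45c RUNG V5 `JordanFive.jordanFive_hasResolution_of_bricks`, brick HP₁ RING SIDE (res-L1-w45c-plan-1
NAMED 2026-08-27T11:35:13Z «stub-2 = HP₁ ring side … R₀ := the ThirdCone.cone side»); the exact
J₅/J_m analogue of res-type-036's `JordanFour.exists_halfConeVertexIdeal` (p509154) with THEOREM T3
(`ThirdCone.isRegular_affineBlowup`, p527123) in place of `Half111.blowup_regular`.
[OURS · L1 W4.5c] — NOT a statement of any manuscript; replaces the role of no printed item.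
Prover res-L1-w45c-stub-2.)

* `ThirdCone.comap_val_span_X_eq_vertexIdeal` — `⟨x_i : w_i ≠ 0⟩ ∩ cone = vertexIdeal`;
* `ThirdCone.comap_span_X_eq_of_passenger_compatible`, `comap_comp_val_span_X_eq_vertexIdeal` — a
  substitution fixing the passengers and mapping non-passengers into `𝔫 = ⟨x_i : w_i ≠ 0⟩` (the
  Artin–Schreier slot `x_c ↦ x_c^p − x_b^{p−1}x_c` of res-L1-w45c-stub-1's `…JordanFiveTwistedChartFixed`)
  pulls `𝔫` back to `𝔫`, so `(θ ∘ val)⁻¹ 𝔫 = vertexIdeal`;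
* `ThirdCone.isPrime_map_vertexIdeal_away`, `isRegular_affineBlowup_map_vertexIdeal_away` — at
  `q ∉ vertexIdeal`: `vertexIdeal · cone[1/q]` is prime and its blow-up is regular
  (`ConeVertex.isRegular_affineBlowup_map_of_isLocalization_away`, p504195);
* `ThirdCone.exists_vertexIdeal_away` — packaged with the contraction identity along
  `cone[1/q] → k[x][1/ι q]` (`ConeVertex.comap_awayMap_map`, p505345): the `hJ₀`/`hreg`/`hJ` inputs of a
  ring brick in the `brickH1` mould.
-/

-- single-problem summit: the doubled namespace component `ResolutionOfSingularities` is forced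
set_option linter.dupNamespace false

noncomputable section

open MvPolynomial AlgebraicGeometry
open Literature.AlgebraicGeometry.Resolution

namespace Summit.ResolutionOfSingularities.ResolutionOfSingularities.Theorems.WildQuotientResolution.ThirdCone

variable (k : Type) [Field k] (n : ℕ) (w : Fin n → ZMod 3)

/-! ## The reduced vertex is cut out by the non-passenger variables -/

/-- `𝔫 ∩ cone = vertexIdeal`: a weight-`0` polynomial lies in the ideal `⟨x_i : w_i ≠ 0⟩` of `k[x]`
iff it lies in the reduced vertex ideal. [OURS · L1 W4.5c] -/
theorem comap_val_span_X_eq_vertexIdeal :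
    Ideal.comap (cone k n w).val.toRingHom
      (Ideal.span ((fun i => (X i : MvPolynomial (Fin n) k)) '' {i | w i ≠ 0})) = vertexIdeal k n w := by
  classical
  apply le_antisymm
  · rintro ⟨f, hf⟩ hmem
    rw [Ideal.mem_comap, AlgHom.toRingHom_eq_coe, RingHom.coe_coe, Subalgebra.coe_val,
      MvPolynomial.mem_ideal_span_X_image] at hmem
    -- decompose into (weight-`0`) monomials, each touching a non-passenger variable
    let μ : (Fin n →₀ ℕ) → cone k n w := fun e =>
      if he : Finsupp.weight w e = 0 then ⟨monomial e 1, monomial_mem_cone k n w he 1⟩ else 0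
    have hμ : ∀ (e) (he : e ∈ f.support), μ e = ⟨monomial e 1,
        monomial_mem_cone k n w (hf (Finsupp.mem_support_iff.mp he)) 1⟩ := by
      intro e he
      have hwe : Finsupp.weight w e = 0 := hf (Finsupp.mem_support_iff.mp he)
      simp [μ, hwe]
    have hdec : (⟨f, hf⟩ : cone k n w) = ∑ e ∈ f.support, coeff e f • μ e := by
      apply Subtype.ext
      change f = ((∑ e ∈ f.support, coeff e f • μ e : cone k n w) : MvPolynomial (Fin n) k)
      rw [AddSubmonoidClass.coe_finsetSum]
      conv_lhs => rw [f.as_sum]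
      refine Finset.sum_congr rfl fun e he => ?_
      rw [Subalgebra.coe_smul, hμ e he, smul_monomial, smul_eq_mul, mul_one]
    rw [hdec]
    refine Ideal.sum_mem _ fun e he => ?_
    rw [Algebra.smul_def]
    refine Ideal.mul_mem_left _ _ ?_
    rw [hμ e he]
    obtain ⟨i, hi, hei⟩ := hmem e he
    exact monomial_mem_vertexIdeal k n w e (hf (Finsupp.mem_support_iff.mp he))
      ⟨i, hi, Nat.one_le_iff_ne_zero.mpr hei⟩
  · refine Ideal.span_le.mpr ?_
    rintro _ ⟨i', rfl⟩
    rw [SetLike.mem_coe, Ideal.mem_comap, AlgHom.toRingHom_eq_coe, RingHom.coe_coe, Subalgebra.coe_val,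
      MvPolynomial.mem_ideal_span_X_image]
    intro m hm
    have hc : ((vertexFamily k n w i' : cone k n w) : MvPolynomial (Fin n) k) =
        monomial (vertexExp n w ((Fintype.equivFin (VIdx n w)).symm i')) 1 := rfl
    rw [hc, support_monomial, if_neg one_ne_zero, Finset.mem_singleton] at hm
    subst hm
    obtain ⟨s, hs, hes⟩ := exists_pos_vertexExp n w ((Fintype.equivFin (VIdx n w)).symm i')
    exact ⟨s, hs, by omega⟩

/-- **Substitutions over the passengers do not move `𝔫`.** If a `k`-algebra endomorphism `θ` of `k[x]`
fixes the passengers and maps every non-passenger variable into `𝔫 = ⟨x_i : w_i ≠ 0⟩` (e.g. the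
Artin–Schreier slot substitution `x_c ↦ x_c^p − x_b^{p−1} x_c`), then `θ⁻¹ 𝔫 = 𝔫`. [OURS · L1 W4.5c] -/
theorem comap_span_X_eq_of_passenger_compatible
    (θ : MvPolynomial (Fin n) k →ₐ[k] MvPolynomial (Fin n) k)
    (hθ₁ : ∀ i, w i ≠ 0 → θ (X i) ∈ Ideal.span ((fun i => (X i : MvPolynomial (Fin n) k)) '' {i | w i ≠ 0}))
    (hθ₀ : ∀ i, w i = 0 → θ (X i) = X i) :
    Ideal.comap (θ : MvPolynomial (Fin n) k →+* MvPolynomial (Fin n) k)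
      (Ideal.span ((fun i => (X i : MvPolynomial (Fin n) k)) '' {i | w i ≠ 0})) =
      Ideal.span ((fun i => (X i : MvPolynomial (Fin n) k)) '' {i | w i ≠ 0}) := by
  classical
  set N := Ideal.span ((fun i => (X i : MvPolynomial (Fin n) k)) '' {i | w i ≠ 0}) with hN
  have hNθ : ∀ g ∈ N, θ g ∈ N := by
    intro g hg
    have : N.map (θ : MvPolynomial (Fin n) k →+* MvPolynomial (Fin n) k) ≤ N := by
      rw [hN, Ideal.map_span, Ideal.span_le]
      rintro _ ⟨_, ⟨i, hi, rfl⟩, rfl⟩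
      exact hθ₁ i hi
    exact this (Ideal.mem_map_of_mem _ hg)
  apply le_antisymm
  · intro f hf
    rw [Ideal.mem_comap, RingHom.coe_coe] at hf
    -- split `f` into its passenger part `f₀` and the rest `f₁ ∈ 𝔫`
    let P : (Fin n →₀ ℕ) → Prop := fun m => ∀ s, m s ≠ 0 → w s = 0
    let f₀ : MvPolynomial (Fin n) k := ∑ m ∈ f.support.filter P, monomial m (coeff m f)
    let f₁ : MvPolynomial (Fin n) k := ∑ m ∈ f.support.filter (fun m => ¬ P m), monomial m (coeff m f)
    have hsplit : f = f₀ + f₁ := by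
      conv_lhs => rw [f.as_sum]
      exact (Finset.sum_filter_add_sum_filter_not _ P _).symm
    have hf₁ : f₁ ∈ N := by
      refine Ideal.sum_mem _ fun m hm => ?_
      obtain ⟨s, hms, hws⟩ : ∃ s, m s ≠ 0 ∧ w s ≠ 0 := by
        have := (Finset.mem_filter.mp hm).2
        simp only [P, not_forall, exists_prop] at this
        exact this
      rw [hN, MvPolynomial.mem_ideal_span_X_image]
      intro m' hm'
      rw [support_monomial, if_neg (MvPolynomial.mem_support_iff.mp (Finset.mem_filter.mp hm).1),
        Finset.mem_singleton] at hm'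
      subst hm'
      exact ⟨s, hws, hms⟩
    have hθf₀ : θ f₀ = f₀ := by
      rw [map_sum]
      refine Finset.sum_congr rfl fun m hm => ?_
      have hP : P m := (Finset.mem_filter.mp hm).2
      rw [← mul_one (coeff m f), ← smul_eq_mul, ← smul_monomial, map_smul, monomial_one_eq_prod_X_pow,
        map_prod]
      congr 1
      refine Finset.prod_congr rfl fun s _ => ?_
      rw [map_pow]
      by_cases hms : m s = 0
      · rw [hms, pow_zero, pow_zero]
      · rw [hθ₀ s (hP s hms)]
    have hf₀N : f₀ ∈ N := by
      have h1 : θ f = f₀ + θ f₁ := by rw [hsplit, map_add, hθf₀]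
      have h2 : f₀ = θ f - θ f₁ := by rw [h1]; ring
      rw [h2]
      exact N.sub_mem hf (hNθ _ hf₁)
    have hf₀0 : f₀ = 0 := by
      by_contra hne
      obtain ⟨m, hm⟩ := MvPolynomial.ne_zero_iff.mp hne
      rw [hN, MvPolynomial.mem_ideal_span_X_image] at hf₀N
      obtain ⟨s, hws, hms⟩ := hf₀N m (MvPolynomial.mem_support_iff.mpr hm)
      -- `m` is in the support of `f₀`, hence passenger-only
      have hm' : m ∈ f.support.filter P := by
        by_contra hnot
        have : coeff m f₀ = 0 := by
          simp only [f₀, coeff_sum, coeff_monomial]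
          refine Finset.sum_eq_zero fun m' hm'' => ?_
          rw [if_neg]
          rintro rfl
          exact hnot hm''
        exact hm this
      exact hws ((Finset.mem_filter.mp hm').2 s hms)
    rw [hsplit, hf₀0, zero_add]
    exact hf₁
  · intro f hf
    rw [Ideal.mem_comap, RingHom.coe_coe]
    exact hNθ f hf

/-- Hence `(θ ∘ val)⁻¹ 𝔫 = vertexIdeal` for such a `θ`. [OURS · L1 W4.5c] -/
theorem comap_comp_val_span_X_eq_vertexIdeal
    (θ : MvPolynomial (Fin n) k →ₐ[k] MvPolynomial (Fin n) k)
    (hθ₁ : ∀ i, w i ≠ 0 → θ (X i) ∈ Ideal.span ((fun i => (X i : MvPolynomial (Fin n) k)) '' {i | w i ≠ 0}))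
    (hθ₀ : ∀ i, w i = 0 → θ (X i) = X i) :
    Ideal.comap ((θ : MvPolynomial (Fin n) k →+* MvPolynomial (Fin n) k).comp (cone k n w).val.toRingHom)
      (Ideal.span ((fun i => (X i : MvPolynomial (Fin n) k)) '' {i | w i ≠ 0})) = vertexIdeal k n w := by
  rw [← Ideal.comap_comap, comap_span_X_eq_of_passenger_compatible k n w θ hθ₁ hθ₀,
    comap_val_span_X_eq_vertexIdeal]

/-! ## Localising at an element off the vertex -/

/-- The extension of the vertex ideal to `cone[1/q]`, `q ∉ vertexIdeal`, is prime. [OURS · L1 W4.5c] -/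
theorem isPrime_map_vertexIdeal_away (q : cone k n w) (hq : q ∉ vertexIdeal k n w)
    (S : Type) [CommRing S] [Algebra (cone k n w) S] [IsLocalization.Away q S] :
    ((vertexIdeal k n w).map (algebraMap (cone k n w) S)).IsPrime := by
  refine IsLocalization.isPrime_of_isPrime_disjoint (Submonoid.powers q) S _ (vertexIdeal_isPrime k n w)
    (Set.disjoint_left.mpr ?_)
  rintro _ ⟨m, rfl⟩ hm
  exact hq ((vertexIdeal_isPrime k n w).mem_of_pow_mem m hm)

/-- `Bl` of `cone[1/q]` along the extended vertex ideal is regular (flat base change of T3).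
[OURS · L1 W4.5c] -/
theorem isRegular_affineBlowup_map_vertexIdeal_away (q : cone k n w)
    (S : Type) [CommRing S] [Algebra (cone k n w) S] [IsLocalization.Away q S] :
    Scheme.IsRegular (affineBlowup ((vertexIdeal k n w).map (algebraMap (cone k n w) S))) :=
  ConeVertex.isRegular_affineBlowup_map_of_isLocalization_away q _ (isRegular_affineBlowup k n w)

/-- **The cone side of a `μ₃` ring brick, localised** (the J₅/`J_m` analogue of
`JordanFour.exists_halfConeVertexIdeal`, p509154): for an embedding `ι : cone → k[x]` that pulls
`𝔫 = ⟨x_i : w_i ≠ 0⟩` back to the vertex ideal (e.g. `θ ∘ val` for a passenger-compatible `θ`,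
`comap_comp_val_span_X_eq_vertexIdeal`), an element `q` off the vertex, `S = cone[1/q]` and
`T = k[x][1/ι q]`: the ideal `J₀ = vertexIdeal · S` is prime, `Bl_{J₀} S` is regular, and `J₀` is
EXACTLY the contraction of `𝔫 · T` along `S → T`. [OURS · L1 W4.5c] -/
theorem exists_vertexIdeal_away (ι : cone k n w →+* MvPolynomial (Fin n) k)
    (hι : Ideal.comap ι (Ideal.span ((fun i => (X i : MvPolynomial (Fin n) k)) '' {i | w i ≠ 0})) =
      vertexIdeal k n w)
    (q : cone k n w) (hq : q ∉ vertexIdeal k n w)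
    (S : Type) [CommRing S] [Algebra (cone k n w) S] [IsLocalization.Away q S]
    (T : Type) [CommRing T] [Algebra (MvPolynomial (Fin n) k) T] [IsLocalization.Away (ι q) T] :
    ∃ J₀ : Ideal S, J₀.IsPrime ∧ Scheme.IsRegular (affineBlowup J₀) ∧
      Ideal.comap (IsLocalization.Away.map S T ι q)
        ((Ideal.span ((fun i => (X i : MvPolynomial (Fin n) k)) '' {i | w i ≠ 0})).map
          (algebraMap (MvPolynomial (Fin n) k) T)) = J₀ := by
  refine ⟨(vertexIdeal k n w).map (algebraMap (cone k n w) S), isPrime_map_vertexIdeal_away k n w q hq S,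
    isRegular_affineBlowup_map_vertexIdeal_away k n w q S, ?_⟩
  rw [ConeVertex.comap_awayMap_map ι q, hι]

end Summit.ResolutionOfSingularities.ResolutionOfSingularities.Theorems.WildQuotientResolution.ThirdCone

end
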